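import Summits.QuantumFields.BalabanUV.Beta.SecondOrderMixedModel

/-!
# `BalabanUV.Beta.SpineRecursiveT2AllModels` — binder row D1, (L4): **hR WITH NO LETTER HYPOTHESIS FOR THE FULLY MODELLED WALL LITERAL** —
# the recursive wall `JsRecWAtOf` v2.26-W at `T := T_W`, `vh₂S := vh₂SModel`, `mixFF := Mmodel` is axis-reflection covariant at EVERY level,
# from the pins only (β sub-cell, row BETA-an2 = BINDER-OWNERS row D1 OWNER, lineage an2 gen 20, K-M2)

HONEST FRAMING (cell charter, verbatim): «discharging BetaPertH makes Balaban's UV stability UNCONDITIONAL — a real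
constructive-QFT result; it is NOT the continuum limit and NOT the Clay problem.»  DERIVED cell leaf (wiring, [folklore]); no statement of
Bałaban's papers, no `[cite:]`, no `def`, no `Prop` fact.  NOT D1, NOT `BetaPertH`, NOT continuum, NOT Clay.

WHAT.  an2-g19's END `SpineRooted.…_JsRecWAtOf_of_letters_antiTwin` (K-G, p219330) takes three letters: Wilson (discharged by an3-g32's
`WilsonReflectionContact2.wilsonW₂_bref_ff_canon_bhKAt` at `T_W := (8N²)⁻¹ • wsym22 N`), border (hBe) for a free anti-twin table, mixed (hM2) for a
free mixed table.  This gen built MODELS of both sockets (`SecondOrderBorderModel.vh₂SModel`: `borderAt_zero_vh₂SModel` + classes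
`SecondOrderBorderModelClass`; `SecondOrderMixedModel.Mmodel`: `mixedPrim_Mmodel` with residual `0` + classes), and an3-g33's
`SecondOrderLetterLevels` lifts both level-0 identities to every level.  Plugging everything in:
**`axisReflectionCovariant_flipK_TbalOf_JsRecWAtOf_models`** (+ `_suN`, `N ≥ 2`):
`∀ j, AxisReflectionCovariant (flipK (TbalOf Lc (JsRecWAtOf … (Lc⁴) (−Lc⁸∕2) cΛ cE₂ cB T_W (locStencil₂_vh₂SModel …) (locStencilFM_Mmodel …) j))`
from EXACTLY: odd `Lc`, a traceless orthonormal complete colour basis (or `2 ≤ N`), `cB ≠ 0`, the END's `γ`/`hγ`, and lock2 (`⟺ cE₂ = Lc⁸`).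
READING (owner, not a claim about Bałaban): the ENTIRE hR architecture of row D1 — (L1) rules 3–4, (L2)/(L3-D′) recursive typing, (L4) W-side
chain, an3's Wilson letter, leaf-05/06/10's classes, an3's level reduction, this gen's socket models — composes to ONE unconditional kernel theorem
for ONE explicit wall literal.  HONEST (referee I-d1ref15-1): the two model tables are NOT identified with Bałaban's second-order averaging jets;
for the ROW's literal (an1's tables) hR still needs an1's two letters (equivalently: an1's tables minus the models are reflection-covariant), and
one table must serve hR/hW/D1Tel/D1Rep + the (R45) ruling.  0∕4 binders of the row.
Provenance: β sub-cell, unit beta-an2 gen 20, 2026-08-20 (v1); no existing file touched.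
-/

open Finset
open scoped BigOperators
open Literature.MathematicalPhysics.QuantumFieldTheory
open Literature.MathematicalPhysics.QuantumFieldTheory.Balaban1983to89
open Literature.MathematicalPhysics.QuantumFieldTheory.Balaban1983to89.Beta
open ExpKernelCalculus (MKer BiLoc)
open AffineAveraging (box toSite)
open AveragingContoursRooted (ctr ctrOff ctrOff_mem_box)
open PolarizationSign (reflSign AxisReflectionCovariant)
open OneStepResolventKernel (Fib)
open OneStepKernelFamily (TbalOf flipK)
open ColourTrace (Complete TrOrthonormal)
open WilsonVertex2Sym (wsym22)
open BalabanStepJetsSucc (wE wVH)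
open BalabanStepW2 (wV4)
open HessKerRate (biLoc_zero)
open Summit.QuantumFields.BalabanUV.Beta.TameKernelCalculus
open Summit.QuantumFields.BalabanUV.Beta.BorderedHessian (bhKStepAt_zero stepScale)
open Summit.QuantumFields.BalabanUV.Beta.SpineRecursiveParity (parityOdd_zero)
open Summit.QuantumFields.BalabanUV.Beta.WilsonReflectionContact2 (wilsonW₂_bref_ff_canon_bhKAt)
open Summit.QuantumFields.BalabanUV.Beta.ColourBasisSU (suGen suGen_complete suGen_trOrthonormal diagIndex ne_zero_of_two_le)
open Summit.QuantumFields.BalabanUV.Beta.SpineRooted (JsRecWAtOf axisReflectionCovariant_flipK_TbalOf_JsRecWAtOf_of_letters_antiTwin lock2_iff)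
open Summit.QuantumFields.BalabanUV.Beta.SecondOrderLetterLevels (levels border_all_of_prim border_prim_of_zero mixed_all_of_prim
  locStencilFM_levels parityOdd_levels)
open Summit.QuantumFields.BalabanUV.Beta.SecondOrderBorderModel (vh₂SModel borderAt_zero_vh₂SModel vh₂SModel_inl_inl vh₂SModel_inr_inr
  vh₂SModel_antiTwin)
open Summit.QuantumFields.BalabanUV.Beta.SecondOrderBorderModelClass (locStencil₂_vh₂SModel vh₂SModel_translate)
open Summit.QuantumFields.BalabanUV.Beta.SecondOrderMixedModel (Mmodel mixedPrim_Mmodel locStencilFM_Mmodel Mmodel_translate)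

namespace Summit.QuantumFields.BalabanUV.Beta.SpineRecursiveT2AllModels

noncomputable section

section Wall

variable {Lc : ℕ} [NeZero Lc]

/-- [folklore] **hR FOR THE FULLY MODELLED WALL LITERAL, NO LETTER HYPOTHESIS** (general colour basis): the recursive wall at
`T := (8N²)⁻¹•wsym22 N`, `vh₂S := vh₂SModel Lc cΛ cB γ`, `mixFF := Mmodel Lc cΛ` is axis-reflection covariant at every level, from odd `Lc`,
the colour data, `cB ≠ 0`, `γ`/`hγ` and lock2 ONLY. -/
theorem axisReflectionCovariant_flipK_TbalOf_JsRecWAtOf_models (hLc : Odd Lc) {N : ℕ} {C : Type*} [Fintype C] [DecidableEq C]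
    {τ : C → Matrix (Fin N) (Fin N) ℂ} (hτ : Complete τ) (ho : TrOrthonormal τ) (hN : N ≠ 0) (c : C) (cΛ cE₂ cB : ℝ) (hcB : cB ≠ 0)
    (γ : ℕ → ℝ) (hγ : ∀ j, γ j = -((Lc : ℝ) ^ 8 / 2) * wVH 3 Lc j / (stepScale 3 Lc j * (Lc : ℝ) ^ 4))
    (hlock2 : ∀ j, cE₂ * wV4 3 Lc (j + 1) * wVH 3 Lc (j + 1) = ((Lc : ℝ) ^ 4 * wE 3 Lc (j + 1)) ^ 2) :
    ∀ j : ℕ, AxisReflectionCovariant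
      (flipK (TbalOf Lc (JsRecWAtOf (d := 3) hLc.pos (ctrOff_mem_box hLc.pos) ((Lc : ℝ) ^ 4) (-((Lc : ℝ) ^ 8 / 2)) cΛ cE₂ cB
        ((8 * (N : ℝ) ^ 2)⁻¹ • wsym22 N) (locStencil₂_vh₂SModel hLc cΛ cB γ) (locStencilFM_Mmodel hLc cΛ)) j)) :=
  axisReflectionCovariant_flipK_TbalOf_JsRecWAtOf_of_letters_antiTwin hLc cΛ cE₂ cB ((8 * (N : ℝ) ^ 2)⁻¹ • wsym22 N)
    (locStencil₂_vh₂SModel hLc cΛ cB γ) (vh₂SModel_inl_inl cΛ cB γ) (locStencilFM_Mmodel hLc cΛ) γ hγ hlock2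
    (levels Lc (fun _ _ _ _ _ => 0)) (fun _ _ _ _ _ => 0)
    (fun α κ u κ' u' x z β β' => by
      simpa only [Pi.zero_apply, add_zero, bhKStepAt_zero] using
        wilsonW₂_bref_ff_canon_bhKAt (d := 3) hτ ho hN c (toSite (ctrOff 4 Lc)) Lc Lc α κ κ' u u' x z β β')
    (fun _ _ _ _ _ _ _ _ _ => rfl) (fun _ _ _ _ _ _ _ _ _ => rfl)
    (fun _ => ⟨0, 1, one_pos, fun κ u κ' u' => by simpa using (biLoc_zero u u (1 : ℝ) : BiLoc (0 : MKer 4 (Fib 3)) u u 0 1)⟩)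
    (fun _ _ _ _ _ => parityOdd_zero)
    (mixed_all_of_prim (toSite (ctrOff 4 Lc)) cΛ hγ (mixedPrim_Mmodel hLc cΛ))
    (locStencilFM_levels fun _ => ⟨0, 1, one_pos, fun κ u ρ w => by simpa using (biLoc_zero u u (1 : ℝ) : BiLoc (0 : MKer 4 (Fib 3)) u u 0 1)⟩)
    (parityOdd_levels fun _ _ _ _ _ => parityOdd_zero)
    (vh₂SModel_antiTwin cΛ cB γ) (vh₂SModel_inr_inr cΛ cB γ)
    (border_all_of_prim (toSite (ctrOff 4 Lc)) cΛ cB hγ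
      (border_prim_of_zero (toSite (ctrOff 4 Lc)) cΛ cB hγ (borderAt_zero_vh₂SModel hLc cΛ cB hcB γ hγ)))
    (vh₂SModel_translate hLc cΛ cB γ) (Mmodel_translate hLc cΛ)

/-- [folklore] **THE `SU(N)` INSTANCE, `N ≥ 2`** (colour basis := `ColourBasisSU.suGen N`, colour := `diagIndex`). -/
theorem axisReflectionCovariant_flipK_TbalOf_JsRecWAtOf_models_suN (hLc : Odd Lc) {N : ℕ} (hN : 2 ≤ N) (cΛ cE₂ cB : ℝ) (hcB : cB ≠ 0)
    (γ : ℕ → ℝ) (hγ : ∀ j, γ j = -((Lc : ℝ) ^ 8 / 2) * wVH 3 Lc j / (stepScale 3 Lc j * (Lc : ℝ) ^ 4))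
    (hlock2 : ∀ j, cE₂ * wV4 3 Lc (j + 1) * wVH 3 Lc (j + 1) = ((Lc : ℝ) ^ 4 * wE 3 Lc (j + 1)) ^ 2) :
    ∀ j : ℕ, AxisReflectionCovariant
      (flipK (TbalOf Lc (JsRecWAtOf (d := 3) hLc.pos (ctrOff_mem_box hLc.pos) ((Lc : ℝ) ^ 4) (-((Lc : ℝ) ^ 8 / 2)) cΛ cE₂ cB
        ((8 * (N : ℝ) ^ 2)⁻¹ • wsym22 N) (locStencil₂_vh₂SModel hLc cΛ cB γ) (locStencilFM_Mmodel hLc cΛ)) j)) :=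
  axisReflectionCovariant_flipK_TbalOf_JsRecWAtOf_models hLc (suGen_complete (ne_zero_of_two_le hN)) (suGen_trOrthonormal N)
    (ne_zero_of_two_le hN) (diagIndex hN) cΛ cE₂ cB hcB γ hγ hlock2


/-- [folklore] **THE PINNED FORM** (`γ` := the END's formula by `rfl`, `cE₂ := Lc⁸` by `SecondOrderLockPin.lock2_iff`): for odd `Lc`, `2 ≤ N`,
any `cΛ` and any `cB ≠ 0`, the fully modelled `SU(N)` wall literal is axis-reflection covariant at every level — NO further hypothesis. -/
theorem axisReflectionCovariant_flipK_TbalOf_JsRecWAtOf_models_pinned (hLc : Odd Lc) {N : ℕ} (hN : 2 ≤ N) (cΛ cB : ℝ) (hcB : cB ≠ 0) :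
    ∀ j : ℕ, AxisReflectionCovariant
      (flipK (TbalOf Lc (JsRecWAtOf (d := 3) hLc.pos (ctrOff_mem_box hLc.pos) ((Lc : ℝ) ^ 4) (-((Lc : ℝ) ^ 8 / 2)) cΛ ((Lc : ℝ) ^ 8) cB
        ((8 * (N : ℝ) ^ 2)⁻¹ • wsym22 N)
        (locStencil₂_vh₂SModel hLc cΛ cB (fun j => -((Lc : ℝ) ^ 8 / 2) * wVH 3 Lc j / (stepScale 3 Lc j * (Lc : ℝ) ^ 4)))
        (locStencilFM_Mmodel hLc cΛ)) j)) :=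
  axisReflectionCovariant_flipK_TbalOf_JsRecWAtOf_models_suN hLc hN cΛ ((Lc : ℝ) ^ 8) cB hcB
    (fun j => -((Lc : ℝ) ^ 8 / 2) * wVH 3 Lc j / (stepScale 3 Lc j * (Lc : ℝ) ^ 4)) (fun _ => rfl) (fun j => (lock2_iff ((Lc : ℝ) ^ 8) j).2 rfl)

end Wall

end

end Summit.QuantumFields.BalabanUV.Beta.SpineRecursiveT2AllModels
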